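import Mathlib
import HarnessLib
import Summits.HubbardSuperconductivity.HubbardSuperconductivity.Theses.ComplexGFFStiffness
import Summits.HubbardSuperconductivity.HubbardSuperconductivity.Theorems.ComplexGFFStiffnessShrunkSlotsHold
import Summits.HubbardSuperconductivity.HubbardSuperconductivity.Theorems.ComplexGFFStiffnessHypALocalTwoPointOfFreeEnergyBounds
import Summits.HubbardSuperconductivity.HubbardSuperconductivity.Theorems.ComplexGFFStiffnessHypACumulantOfOnePointLipschitz
import Summits.HubbardSuperconductivity.HubbardSuperconductivity.Theorems.ComplexGFFStiffnessHypACumulantStubGnvOfFrd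

/-!
# The glue of the RE-TYPED split of `HypACumulant` / `HypALocalTwoPoint` (route ComplexGFFStiffness rev 5,
# shrunk-package repair R1) — PROVED; closes the glue items BY NAME

Route `route-HubbardSuperconductivity-ComplexGFFStiffness`, file rev 5 (commit 523e8dfe6073, `ledger route edit`
by the strategist seat cstrat-stmt-HubbardSuperconductivity-19154 g1, director-hubbard g26 docket, ladder REQUESTS
l.67476).  The children of `HypACumulant` (stmt-…-19154) were RE-TYPED so that the SHRUNK-PACKAGE slot theorems
(`P.shrink := {P with r := P.r/8}`, `AbkmPackageShrink`; vocabulary `AbkmPackageShrunkSlots`) close them by name: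

* `TwoKernelSkBound`   (stmt-…-27414) `:= GradientRG.TwoKernelSkBound 4 ∧ GradientRG.F4l2Shrink 4`
* `L2GaussianCore`     (stmt-…-27378, CLOSED) `:= GradientRG.L2GaussianCore 4`
* `F4StatementOfCores` (stmt-…-27415, CLOSED 14:36Z by g14's `F4StatementOfCores_proof`) `:= GradientRG.TwoKernelSkBound 4 → GradientRG.F4lPrimeShrink 4`
* `H1bcStatement`      (stmt-…-27416, CLOSED 14:36Z by g14's `H1bcStatement_proof`) `:= GradientRG.H1bcStatementShrink 4`
* `F1Residual`         (stmt-…-27417) `:= GradientRG.F4StatementShrink 4 → GradientRG.H1bcStatementShrink 4 → ComplexGFF.FreeEnergyBounds`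
* glue `HypACumulantGlue` (stmt-…-27382) `:= TwoKernelSkBound → L2GaussianCore → F4StatementOfCores → H1bcStatement → F1Residual → HypACumulant`
* sibling `HypALocalTwoPoint` (stmt-…-19155): `TwoPointGivenZ` (stmt-…-27383), `ZNonvanishing` (stmt-…-27384, CLOSED),
  glue `HypALocalTwoPointGlue` (stmt-…-27385) `:= TwoPointGivenZ → ZNonvanishing → HypALocalTwoPoint`.

This file proves, sorry-free with the standard axioms (citing, not restating, cgffstiff-1 g14's landed
`ComplexGFF.f4StatementShrink_of_cores : TwoKernelSkBound d → F4l2Shrink d → F4StatementShrink d`, p825763):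
* §1 `ComplexGFF.freeEnergyBounds_of_shrunk`, `cumulantGivenZ_of_shrunk`, `twoPointGivenZ_of_shrunk` and the threshold
  merges `hypACumulant_of_cumulantGivenZ`, `hypALocalTwoPoint_of_twoPointGivenZ` (`L₀ := max`, `g₀ := min`);
* §2 BY NAME over the route decls: `HypACumulantGlue_proof` (closes stmt-…-27382), `HypALocalTwoPointGlue_proof`
  (closes stmt-…-27385), `twoPointGivenZ_item_of_cores` (the closer of stmt-…-27383 once the five children hold),
  `HypACumulant_of_subs`, `HypALocalTwoPoint_of_subs`, `complexGFF4Stiffness_of_subs` (through the route's own `closes`).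
  (The NODE-CONTRACT monotonicity lemmas — old full-radius texts ⟹ new texts — live in the strategist's evidence file
  SplitCheck.lean, not here: they are conditional on unregistered hypotheses and would be tree orphans.)

It SUPERSEDES the rev-4 evidence file `ComplexGFFStiffnessHypACumulantSplit.lean` of the g0 seat (stale child texts).
Honest scope: typing / bookkeeping for a RUNG route (stiffness of a complex Gaussian gradient field via the [ABKM19] RG,
ladder Hubbard H2gff / 1c); superconductivity in the Hubbard model is NOT advanced.

References: S. Adams, S. Buchholz, R. Kotecký, S. Müller, arXiv:1910.13564, Thm 2.2 / Thm 6.8 / Lemma 8.4 / Lemma 12.6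
[AdamsBuchholzKoteckyMuller2019].
-/

noncomputable section

set_option linter.dupNamespace false

/-! ## §1 Summit-level glue over the re-typed child TEXTS (rev 5) -/

namespace Summit.HubbardSuperconductivity.HubbardSuperconductivity.Theorems.ComplexGFF

open Literature.MathematicalPhysics.StatisticalMechanics.ComplexGradientGFF4 (Z ev Y D CumulantBoundAt LocalTwoPointAt)
open Literature.MathematicalPhysics.StatisticalMechanics

/-- `FreeEnergyBounds` from the five re-typed children (texts of stmt-…-27414, 27378, 27415, 27416, 27417, route rev 5):
the nine shrunk `q`-slots come from the two-kernel bundle `h₁` through cgffstiff-1 g14's LANDED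
`ComplexGFF.f4StatementShrink_of_cores : TwoKernelSkBound d → F4l2Shrink d → F4StatementShrink d`
(`Theorems/ComplexGFFStiffnessShrunkSlotsHold.lean`, p825763 — it already contains (F4l') via
`f4lPrimeShrink_of_twoKernelSkBound`, so the children `L2GaussianCore` / `F4StatementOfCores`, both CLOSED, are not
re-consumed here), the state slot is `h₄`, and `F1Residual` = `h₅` assembles. -/
theorem freeEnergyBounds_of_shrunk
    (h₁ : GradientRG.TwoKernelSkBound 4 ∧ GradientRG.F4l2Shrink 4) (_h₂ : GradientRG.L2GaussianCore 4)
    (_h₃ : GradientRG.TwoKernelSkBound 4 → GradientRG.F4lPrimeShrink 4) (h₄ : GradientRG.H1bcStatementShrink 4)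
    (h₅ : GradientRG.F4StatementShrink 4 → GradientRG.H1bcStatementShrink 4 → FreeEnergyBounds) :
    FreeEnergyBounds :=
  h₅ (f4StatementShrink_of_cores h₁.1 h₁.2) h₄

/-- `CumulantGivenZ` from the five re-typed children (via `FreeEnergyBounds → OnePointLipschitz → CumulantGivenZ`). -/
theorem cumulantGivenZ_of_shrunk
    (h₁ : GradientRG.TwoKernelSkBound 4 ∧ GradientRG.F4l2Shrink 4) (h₂ : GradientRG.L2GaussianCore 4)
    (h₃ : GradientRG.TwoKernelSkBound 4 → GradientRG.F4lPrimeShrink 4) (h₄ : GradientRG.H1bcStatementShrink 4)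
    (h₅ : GradientRG.F4StatementShrink 4 → GradientRG.H1bcStatementShrink 4 → FreeEnergyBounds) :
    CumulantGivenZ :=
  cumulantGivenZ_of_onePointLipschitz
    (onePointLipschitz_of_freeEnergyBounds' (freeEnergyBounds_of_shrunk h₁ h₂ h₃ h₄ h₅))

/-- `TwoPointGivenZ` from the five re-typed children (via `FreeEnergyBounds → TwoPointGivenZ`). -/
theorem twoPointGivenZ_of_shrunk
    (h₁ : GradientRG.TwoKernelSkBound 4 ∧ GradientRG.F4l2Shrink 4) (h₂ : GradientRG.L2GaussianCore 4)
    (h₃ : GradientRG.TwoKernelSkBound 4 → GradientRG.F4lPrimeShrink 4) (h₄ : GradientRG.H1bcStatementShrink 4)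
    (h₅ : GradientRG.F4StatementShrink 4 → GradientRG.H1bcStatementShrink 4 → FreeEnergyBounds) :
    TwoPointGivenZ :=
  twoPointGivenZ_of_freeEnergyBounds (freeEnergyBounds_of_shrunk h₁ h₂ h₃ h₄ h₅)

/-- Threshold merge: `ZNonvanishing` + `CumulantGivenZ` give the body of the crux `HypACumulant` (`L₀ := max`, `g₀ := min`). -/
theorem hypACumulant_of_cumulantGivenZ (hZ : ZNonvanishing) (h₂ : CumulantGivenZ) :
    ∃ L₀ : ℕ, ∀ L : ℕ, Odd L → L₀ ≤ L → ∃ g₀ C : ℝ, 0 < g₀ ∧ CumulantBoundAt L g₀ C := by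
  obtain ⟨L₁, h₁⟩ := hZ
  obtain ⟨L₂, h₂⟩ := h₂
  refine ⟨max L₁ L₂, fun L hL hle => ?_⟩
  obtain ⟨g₁, hg₁, hZ'⟩ := h₁ L hL (le_trans (le_max_left _ _) hle)
  obtain ⟨g₂, C, hg₂, hC⟩ := h₂ L hL (le_trans (le_max_right _ _) hle)
  refine ⟨min g₁ g₂, C, lt_min hg₁ hg₂, ?_⟩
  intro g hg0 hg N hN n _ hn
  have hz : Z n g 0 ≠ 0 := hZ' g hg0 (le_trans hg (min_le_left _ _)) N hN n hn
  exact ⟨hz, hC g hg0 (le_trans hg (min_le_right _ _)) N hN n hn hz⟩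

/-- Threshold merge: `ZNonvanishing` + `TwoPointGivenZ` give the body of the crux `HypALocalTwoPoint`. -/
theorem hypALocalTwoPoint_of_twoPointGivenZ (hZ : ZNonvanishing) (h₂ : TwoPointGivenZ) :
    ∃ L₀ : ℕ, ∀ L : ℕ, Odd L → L₀ ≤ L → ∃ g₀ C : ℝ, 0 < g₀ ∧ LocalTwoPointAt L g₀ C := by
  obtain ⟨L₁, h₁⟩ := hZ
  obtain ⟨L₂, h₂⟩ := h₂
  refine ⟨max L₁ L₂, fun L hL hle => ?_⟩
  obtain ⟨g₁, hg₁, hZ'⟩ := h₁ L hL (le_trans (le_max_left _ _) hle)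
  obtain ⟨g₂, C, hg₂, hC⟩ := h₂ L hL (le_trans (le_max_right _ _) hle)
  refine ⟨min g₁ g₂, C, lt_min hg₁ hg₂, ?_⟩
  intro g hg0 hg N hN n _ hn
  have hz : Z n g 0 ≠ 0 := hZ' g hg0 (le_trans hg (min_le_left _ _)) N hN n hn
  exact ⟨hz, hC g hg0 (le_trans hg (min_le_right _ _)) N hN n hn hz⟩

end Summit.HubbardSuperconductivity.HubbardSuperconductivity.Theorems.ComplexGFF

/-! ## §2 The glue items BY NAME over the route decls (rev 5) -/

namespace Summit.HubbardSuperconductivity.HubbardSuperconductivity.Theorems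

open Summit.HubbardSuperconductivity.HubbardSuperconductivity.Theses.ComplexGFFStiffness
  (HypACumulant HypALocalTwoPoint TwoKernelSkBound L2GaussianCore F4StatementOfCores H1bcStatement F1Residual
   HypACumulantGlue TwoPointGivenZ ZNonvanishing HypALocalTwoPointGlue ComplexGFF4Stiffness closes)

/-- **Glue item `HypACumulantGlue` (stmt-HubbardSuperconductivity-27382) holds** over the re-typed children:
`TwoKernelSkBound → L2GaussianCore → F4StatementOfCores → H1bcStatement → F1Residual → HypACumulant`.
[cite: AdamsBuchholzKoteckyMuller2019, Thm 2.2 / Lemma 12.6] -/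
theorem HypACumulantGlue_proof :
    Summit.HubbardSuperconductivity.HubbardSuperconductivity.Theses.ComplexGFFStiffness.HypACumulantGlue := by
  unfold Summit.HubbardSuperconductivity.HubbardSuperconductivity.Theses.ComplexGFFStiffness.HypACumulantGlue
  intro h₁ h₂ h₃ h₄ h₅
  exact ComplexGFF.hypACumulant_of_cumulantGivenZ ComplexGFF.zNonvanishing
    (ComplexGFF.cumulantGivenZ_of_shrunk h₁ h₂ h₃ h₄ h₅)

/-- **Glue item `HypALocalTwoPointGlue` (stmt-HubbardSuperconductivity-27385) holds**:
`TwoPointGivenZ → ZNonvanishing → HypALocalTwoPoint` (threshold merge). -/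
theorem HypALocalTwoPointGlue_proof :
    Summit.HubbardSuperconductivity.HubbardSuperconductivity.Theses.ComplexGFFStiffness.HypALocalTwoPointGlue := by
  unfold Summit.HubbardSuperconductivity.HubbardSuperconductivity.Theses.ComplexGFFStiffness.HypALocalTwoPointGlue
  intro h hZ
  exact ComplexGFF.hypALocalTwoPoint_of_twoPointGivenZ hZ h

/-- The closer of `TwoPointGivenZ` (stmt-HubbardSuperconductivity-27383) once the five re-typed children hold. -/
theorem twoPointGivenZ_item_of_cores :
    TwoKernelSkBound → L2GaussianCore → F4StatementOfCores → H1bcStatement → F1Residual → TwoPointGivenZ :=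
  fun h₁ h₂ h₃ h₄ h₅ => ComplexGFF.twoPointGivenZ_of_shrunk h₁ h₂ h₃ h₄ h₅

/-- The parent `HypACumulant` from the five re-typed children. -/
theorem HypACumulant_of_subs (h₁ : TwoKernelSkBound) (h₂ : L2GaussianCore) (h₃ : F4StatementOfCores)
    (h₄ : H1bcStatement) (h₅ : F1Residual) : HypACumulant :=
  HypACumulantGlue_proof h₁ h₂ h₃ h₄ h₅

/-- The parent `HypALocalTwoPoint` from the five re-typed children (and the landed `zNonvanishing`). -/
theorem HypALocalTwoPoint_of_subs (h₁ : TwoKernelSkBound) (h₂ : L2GaussianCore) (h₃ : F4StatementOfCores)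
    (h₄ : H1bcStatement) (h₅ : F1Residual) : HypALocalTwoPoint :=
  HypALocalTwoPointGlue_proof (twoPointGivenZ_item_of_cores h₁ h₂ h₃ h₄ h₅) ComplexGFF.zNonvanishing

/-- The route's rung leaf from the five re-typed children, through the route's UNCHANGED `closes`. -/
theorem complexGFF4Stiffness_of_subs (h₁ : TwoKernelSkBound) (h₂ : L2GaussianCore) (h₃ : F4StatementOfCores)
    (h₄ : H1bcStatement) (h₅ : F1Residual) : ComplexGFF4Stiffness :=
  closes (HypACumulant_of_subs h₁ h₂ h₃ h₄ h₅) (HypALocalTwoPoint_of_subs h₁ h₂ h₃ h₄ h₅)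

end Summit.HubbardSuperconductivity.HubbardSuperconductivity.Theorems

end
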